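import Summits.QuantumFields.YangMills.Theorems.LangevinControlUVOSLegsFromFemtoAndGapDefs
import Summits.QuantumFields.YangMills.Theorems.LangevinControlUVOSLegsFromFemtoAndGapStubAssemblyLatticeDist
import Literature.MathematicalPhysics.QuantumFieldTheory.LatticeGaugeProofs
import HarnessLib

/-!
# Soft OS-assembly toolkit VI-a: the collar output `MomentBounds` in the currency of `latticeDist`

Helper file for stub `stub_assembly` of crux `OSLegsFromFemtoAndGap` (stmt-QuantumFields-9367, line
`dlr-collar-transfer`).  The line's collar stub delivers `MomentBounds G r a`: centred torus moments of the
action density `dens` at pairwise torus-separated sites are `≤ (C/R⁴)ⁿ`, each site centred by ITS OWN torus mean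
`torusE (dens xᵢ)`.  The lattice `n`-point distribution `latticeDist` (toolkit III) is built on `torusMoment` with
ONE additive normalisation `m`.  Torus translation invariance of Wilson's measure (tree:
`wilsonExpectation_comp_torusConfigShift`, `toTorusObservable_comp_configShift`) identifies the two:
* `torusE_dens_eq_wilsonTorusMean` — `torusE (dens x) = wilsonTorusMean r.ρ β L r.curvature.F` for every `x`;
* `torusE_prod_eq_torusMoment` — the quantity bounded by `MomentBounds` IS
  `torusMoment r.ρ β L r.curvature.F (wilsonTorusMean …) x`;
* `abs_torusMoment_le_pow` — the trivial bound `|torusMoment| ≤ (2 M)ⁿ` from `|dens| ≤ M`;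
* `abs_torusMoment_le_of_momentBounds` — `MomentBounds` restated for `torusMoment`.
-/

noncomputable section

open scoped SchwartzMap BigOperators
open MeasureTheory Filter Topology
open Literature.MathematicalPhysics.QuantumFieldTheory Literature.MathematicalPhysics.QuantumLattice
open Literature.Probability.LatticeModels (box Site)
open Summit.QuantumFields.YangMills.Cruxes.OSLegsFromFemtoAndGap.DlrCollarTransfer (torusE dens MomentBounds)

namespace Summit.QuantumFields.YangMills.Theorems.OSLegsFromFemtoAndGap

variable {G : Type} [Group G] [TopologicalSpace G] [IsTopologicalGroup G] [CompactSpace G]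
  [MeasurableSpace G] [BorelSpace G]

/-- `torusE` is a torus Wilson expectation of the observable read through the periodic lift. -/
theorem torusE_eq_wilsonExpectation (r : LatticeRep G) (β : ℝ) (L : ℕ) (F : LGConfig 4 G → ℝ) :
    torusE G r β L F = wilsonExpectation (d := 4) (L := 2 * L + 1) r.ρ β (toTorusObservable (2 * L + 1) F) :=
  rfl

/-- The action density at `x` is the action density at `0` composed with the lattice translation by `-x`. -/
theorem dens_eq_comp_configShift (r : LatticeRep G) (x : Site 4) :
    dens G r x = r.curvature.F ∘ configShift (-x) :=
  rfl

/-- **The torus mean of the action density does not depend on the site** (translation invariance of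
Wilson's measure on the torus): `torusE (dens x) = wilsonTorusMean r.ρ β L r.curvature.F`. -/
theorem torusE_dens_eq_wilsonTorusMean (r : LatticeRep G) (β : ℝ) (L : ℕ) (x : Site 4) :
    torusE G r β L (dens G r x) = wilsonTorusMean r.ρ β L r.curvature.F := by
  rw [torusE_eq_wilsonExpectation, dens_eq_comp_configShift, toTorusObservable_comp_configShift,
    wilsonExpectation_comp_torusConfigShift]
  simp [wilsonExpectation, wilsonTorusMean, toTorusObservable]

/-- **The moment bounded by `MomentBounds` is `torusMoment` with the canonical centring.** -/
theorem torusE_prod_eq_torusMoment (r : LatticeRep G) (β : ℝ) (L : ℕ) {n : ℕ} (x : Fin n → Site 4) :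
    torusE G r β L (fun U => ∏ i, (dens G r (x i) U - torusE G r β L (dens G r (x i)))) =
      torusMoment r.ρ β L r.curvature.F (wilsonTorusMean r.ρ β L r.curvature.F) x := by
  simp only [torusE_dens_eq_wilsonTorusMean]
  rfl

/-- **Trivial bound**: `|torusMoment r.ρ β L s.F m x| ≤ (M + |m|)ⁿ` whenever `|s.F| ≤ M`. -/
theorem abs_torusMoment_le_pow (r : LatticeRep G) (β : ℝ) (L : ℕ) (s : YMSpecies G) {M : ℝ}
    (hM : ∀ U, |s.F U| ≤ M) (m : ℝ) {n : ℕ} (x : Fin n → Site 4) :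
    |torusMoment r.ρ β L s.F m x| ≤ (M + |m|) ^ n := by
  haveI := isProbabilityMeasure_wilsonMeasure (d := 4) (L := 2 * L + 1) r.ρ r.continuous β
  have hM0 : 0 ≤ M := le_trans (abs_nonneg _) (hM (fun _ => 1))
  unfold torusMoment
  have hbound : ∀ U : GaugeConfig 4 (2 * L + 1) G,
      ‖∏ i, (s.F (configShift (-(x i)) (torusLift (2 * L + 1) U)) - m)‖ ≤ (M + |m|) ^ n := fun U => by
    rw [Real.norm_eq_abs, Finset.abs_prod]
    calc ∏ i, |s.F (configShift (-(x i)) (torusLift (2 * L + 1) U)) - m|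
        ≤ ∏ _i : Fin n, (M + |m|) := Finset.prod_le_prod (fun _ _ => abs_nonneg _) fun i _ =>
          (abs_sub _ _).trans (add_le_add (hM _) le_rfl)
      _ = (M + |m|) ^ n := by simp
  have h := norm_integral_le_of_norm_le_const (μ := wilsonMeasure (d := 4) (L := 2 * L + 1) r.ρ β)
    (Eventually.of_forall hbound)
  simpa [Real.norm_eq_abs] using h

/-- The torus mean is bounded by the sup of the observable. -/
theorem abs_wilsonTorusMean_le (r : LatticeRep G) (β : ℝ) (L : ℕ) (s : YMSpecies G) {M : ℝ}
    (hM : ∀ U, |s.F U| ≤ M) : |wilsonTorusMean r.ρ β L s.F| ≤ M := by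
  haveI := isProbabilityMeasure_wilsonMeasure (d := 4) (L := 2 * L + 1) r.ρ r.continuous β
  unfold wilsonTorusMean
  have h := norm_integral_le_of_norm_le_const (μ := wilsonMeasure (d := 4) (L := 2 * L + 1) r.ρ β)
    (f := fun U => s.F (torusLift (2 * L + 1) U)) (C := M)
    (Eventually.of_forall fun U => by simpa [Real.norm_eq_abs] using hM _)
  simpa [Real.norm_eq_abs] using h

/-- **`MomentBounds` in the currency of `torusMoment`.** -/
theorem abs_torusMoment_le_of_momentBounds (r : LatticeRep G) {a : ℝ → ℝ} (h : MomentBounds G r a) :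
    ∃ (C β₄ ℓ₄ : ℝ), 0 < ℓ₄ ∧ 0 ≤ C ∧ ∀ β : ℝ, β₄ ≤ β → ∀ (L n : ℕ) (x : Fin n → Site 4) (R : ℕ),
      1 ≤ R → (R : ℝ) * a β ≤ ℓ₄ → 4 * R + 8 ≤ L →
      (∀ i j : Fin n, i ≠ j → ∃ k : Fin 4,
        (2 * (R : ℤ) + 4) ≤ |((((x i k - x j k : ℤ) : ZMod (2 * L + 1))).valMinAbs : ℤ)|) →
      |torusMoment r.ρ β L r.curvature.F (wilsonTorusMean r.ρ β L r.curvature.F) x| ≤ (C / (R : ℝ) ^ 4) ^ n := by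
  obtain ⟨C, β₄, ℓ₄, hℓ, hC, H⟩ := h
  refine ⟨C, β₄, ℓ₄, hℓ, hC, fun β hβ L n x R hR hRa hRL hsep => ?_⟩
  rw [← torusE_prod_eq_torusMoment]
  exact H β hβ L n x R hR hRa hRL hsep

end Summit.QuantumFields.YangMills.Theorems.OSLegsFromFemtoAndGap

end
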